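import Mathlib
import Literature.NumberTheory.LFunctions.Zhang2022.Section15GammaFactorSteps
import Literature.NumberTheory.LFunctions.Zhang2022.Section15Step15u002
import Literature.NumberTheory.LFunctions.Zhang2022.Section13U007b
import Literature.NumberTheory.LFunctions.Zhang2022.Section13MeanSquareNB
import Literature.NumberTheory.LFunctions.Zhang2022.Section13MeanSquareB
import Literature.NumberTheory.LFunctions.Zhang2022.Section13MeanSquareTools
import Literature.NumberTheory.LFunctions.Zhang2022.Section13E1Reduction
import Literature.NumberTheory.LFunctions.Zhang2022.Section13ConjugateAFE
import Literature.NumberTheory.LFunctions.Zhang2022.Section5Lemma59Ded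
import Literature.NumberTheory.LFunctions.Zhang2022.Section6Lemma61Closed
import Literature.NumberTheory.LFunctions.Zhang2022.Section6ZfacSize
import Literature.NumberTheory.LFunctions.Zhang2022.Section8Eq81bEdge
import Literature.NumberTheory.LFunctions.Zhang2022.Section14Prop141Discharge
import Literature.NumberTheory.LFunctions.Zhang2022.Section14Eq143Core
import Literature.NumberTheory.LFunctions.Zhang2022.Section2FrakP
import Literature.NumberTheory.LFunctions.Zhang2022.Section4Prop22Eventually
import HarnessLib

/-!
# Zhang (2022) §15, node Z22:§15.u008, part (β): the MEAN VALUE of the reflected main term `M₁ω`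
# on `𝔍(−α)` over `ψ ∈ Ψ₁` (RT15-int-1), kernel-checked

Topic `Literature/NumberTheory/LFunctions/Zhang2022` (Landau–Siegel audit tree; verdict-neutral).
Y. Zhang, *Discrete mean estimates and the Landau–Siegel zero*, arXiv:2211.02515v1 (2022)
[Zhang2022LandauSiegel] — **an unrefereed manuscript under adjudication; nothing here asserts or denies
its Theorems 1–2.** Lane ZHANG-L, WP15, leaf h15_6 (`Typed.Section15A.Eq15_6 c′ bChi`), node
`Z22:§15.u008` (§15 p. 80, tex L4017–L4033), WP-internal route RT15-int-1 (u008 ⇐ (α) pointwise on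
`𝔍(−α)` ∘ (β) mean value on `𝔍(−α)` ∘ (γ) exact move ∘ (δ) = u007): the relative error `O(𝓛⁻¹²³)` of
u004/u006 is absorbed into `o(𝔓)` through the bound of THIS file,
`Σ_{ψ∈Ψ₁} ∫_{𝔍(−α)} ‖M₁(s,ψ)ω(s)‖ |ds| ≪ 𝔓·𝓛^{122}` (tex L4020 "the total contribution of the
`O(𝓛⁻¹²³)` term is `o(𝔓)`", which has no typed node), where
`M₁(s,ψ) = τ(χ)χ(p)ψ̄(D)(pt₀)^{−β₃}D^{s−1}·[L(1−s−β₁,ψ̄)L(1−s−β₂,ψ̄)/L(1−s,ψ̄)]·B(s,ψ)K(1−s−β₃,ψ̄)` is the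
main term of `Typed.Section15A.step15_u008alpha_holds` (same term order; no new definition).

Route (every input a tree theorem): with `u = 1 − s̄` (`Re u = ½ + α`), `|τ(χ)D^{s−1}| = D^{−α} ≤ 1`,
`L(1−s−β,ψ̄) = conj L(u+β,ψ)`, `K(1−s−β₃,ψ̄) = conj K(u+β₃,ψ)`; Lemma 5.9 at `u` (zeros of `L(·,ψ)`, `ψ ∈ Ψ₁`,
are `≥ α` away by Prop. 2.2 (i)) removes `L(u+β₁,ψ)/L(u,ψ) ≪ log P`; Lemma 6.1 (reflected form, under
(A)) splits `L(u+β₂,ψ)` into `K(u+β₂,ψ)`, `Z·N` (`|Z| ≤ e¹⁶`, `|N(1−u−β₂,ψ̄)| = |N(s+β₂,ψ)|`), `E₁(s+β₂,ψ)`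
and `ε`; Cauchy–Schwarz over `ψ` with Lemma 3.3: the products `K·K`, `N·K`, `D_{T³}·K` by the large sieve
(`P²𝓛³⁶`), `B` and `K` alone by orthogonality (`𝔓𝓛³⁶`, `𝔓𝓛⁹`). Pointwise on `𝔍(−α)`:
`Σ_{ψ∈Ψ₁}‖M₁(s,ψ)‖ ≤ C·P·√𝔓·𝓛⁴⁵`; integrating `|ω| ≤ e√π𝓛⁻⁴⁰⁰` over `|v| ≤ 𝓛₁` and `P ≤ √2·𝔓^{1/2}𝓛^{38.5}`
((2.9)) gives `≤ C·𝔓·𝓛⁸⁹ ≤ C·𝔓·𝓛¹²²` for `𝓛 ≥ 1`. Hypotheses: `c′ ≥ 0` and `Skeleton.Prop22 c′` (as in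
the (8.1) engine; `_eventually` form via `Skeleton.prop22_eventually`).

WHAT THIS IS NOT: the pointwise rewriting (α) (`Section15U008Alpha`), the move (γ), or u008 itself. No
claim about Landau–Siegel zeros.

## References

* Y. Zhang, arXiv:2211.02515v1 (2022), §15 p. 80, tex L4017–L4033; §5 Lemma 5.9; §6 Lemma 6.1; §3
  Lemma 3.3; §2 (2.9). [cite: Zhang2022LandauSiegel, §15 p. 80]
-/

noncomputable section

open Complex Real ComplexConjugate MeasureTheory

namespace Literature.NumberTheory.LFunctions.Zhang2022.Typed.Section15A

open Literature.NumberTheory.LFunctions.Zhang2022.Skeleton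
open MeanSquareMajorant Typed.Section13

/-! ## Part A. Polynomial rewritings, lengths, and the five mean squares -/

section PartA

variable {D : ℕ}

/-- `K(s+γ,ψ) = Σ_{1≤m<⌈2P₄⌉} [m^{−γ}g*(P₄/m)]·ψ(m)·m^{−s}` (the shift carried by the coefficient; twin of
`Typed.Section13.Nchar_shift_eq_sum`). [cite: Zhang2022LandauSiegel, §6 Lemma 6.1 p.30] -/
theorem Kchar_shift_eq_sum (x : Chr D) (s γ : ℂ) :
    Kchar D (psiFn x) (s + γ) =
      ∑ m ∈ Finset.Ico 1 ⌈2 * P4 D⌉₊,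
        ((m : ℂ) ^ (-γ) * (gstar D (P4 D / m) : ℂ)) * x.ψ (m : ZMod x.p) * (m : ℂ) ^ (-s) := by
  unfold Kchar psiFn
  refine Finset.sum_congr rfl fun m hm => ?_
  rw [Finset.mem_Ico] at hm
  have hm0 : (m : ℂ) ≠ 0 := by exact_mod_cast (show m ≠ 0 by omega)
  rw [neg_add, Complex.cpow_add _ _ hm0]
  ring

/-- `Σ_{1≤n<N} ψ(n)n^{−(s+γ)} = Σ_{1≤n<N} [n^{−γ}]·ψ(n)·n^{−s}` (the `E₁`-polynomial `D_{T³}` with its shift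
in the coefficient). [cite: Zhang2022LandauSiegel, §6 Lemma 6.1 p.30] -/
theorem dirPoly_shift_eq_sum (x : Chr D) (N : ℕ) (s γ : ℂ) :
    ∑ n ∈ Finset.Ico 1 N, x.ψ (n : ZMod x.p) * (n : ℂ) ^ (-(s + γ)) =
      ∑ n ∈ Finset.Ico 1 N, ((n : ℂ) ^ (-γ)) * x.ψ (n : ZMod x.p) * (n : ℂ) ^ (-s) := by
  refine Finset.sum_congr rfl fun n hn => ?_
  rw [Finset.mem_Ico] at hn
  have hn0 : (n : ℂ) ≠ 0 := by exact_mod_cast (show n ≠ 0 by omega)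
  rw [neg_add, Complex.cpow_add _ _ hn0]
  ring

/-- `|m^{−γ}| ≤ 1` for `m ≥ 1` and `Re γ ≥ 0`. [folklore] -/
private theorem norm_natCast_cpow_neg_le_one {m : ℕ} (hm : m ≠ 0) {γ : ℂ} (hγ : 0 ≤ γ.re) :
    ‖(m : ℂ) ^ (-γ)‖ ≤ 1 := by
  rw [Complex.norm_natCast_cpow_of_pos (Nat.pos_of_ne_zero hm), Complex.neg_re]
  exact Real.rpow_le_one_of_one_le_of_nonpos (by exact_mod_cast Nat.one_le_iff_ne_zero.mpr hm)
    (by linarith)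

/-- The coefficient of `K(s+γ,ψ)` has modulus `≤ 1 = τ₁(m)` when `Re γ ≥ 0` (`|g*| ≤ 1`).
[cite: Zhang2022LandauSiegel, §6 Lemma 6.1 p.30; §4 (4.1)] -/
theorem norm_Kchar_coeff_le (hL : 0 < ell D) {γ : ℂ} (hγ : 0 ≤ γ.re) (m : ℕ) (hm : m ≠ 0) :
    ‖(m : ℂ) ^ (-γ) * (gstar D (P4 D / m) : ℂ)‖ ≤ 1 * tau 1 m := by
  rw [tau_one_apply hm, mul_one, norm_mul]
  calc ‖(m : ℂ) ^ (-γ)‖ * ‖(gstar D (P4 D / m) : ℂ)‖ ≤ 1 * 1 :=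
        mul_le_mul (norm_natCast_cpow_neg_le_one hm hγ) (norm_gstar_le_one hL _) (norm_nonneg _)
          zero_le_one
    _ = 1 := one_mul 1

/-- The coefficient `n^{−γ}` of the `E₁`-polynomial has modulus `≤ 1 = τ₁(n)` when `Re γ ≥ 0`.
[cite: Zhang2022LandauSiegel, §6 Lemma 6.1 p.30] -/
theorem norm_dirPoly_coeff_le {γ : ℂ} (hγ : 0 ≤ γ.re) (n : ℕ) (hn : n ≠ 0) :
    ‖(n : ℂ) ^ (-γ)‖ ≤ 1 * tau 1 n := by
  rw [tau_one_apply hn, mul_one]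
  exact norm_natCast_cpow_neg_le_one hn hγ

/-- `T⁵ ≤ P` once `𝓛 ≥ 3` (`5𝓛^{1.1} ≤ 5𝓛² ≤ 𝓛⁹`). [cite: Zhang2022LandauSiegel, §2 (2.6); §6 p.12] -/
theorem bigT_pow_five_le_bigP (hL : 3 ≤ ell D) : bigT D ^ 5 ≤ bigP D := by
  have hL1 : 1 ≤ ell D := by linarith
  have hL0 : 0 < ell D := by linarith
  have h11 : ell D ^ (1.1 : ℝ) ≤ ell D ^ 2 := by
    calc ell D ^ (1.1 : ℝ) ≤ ell D ^ ((2 : ℕ) : ℝ) :=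
          Real.rpow_le_rpow_of_exponent_le hL1 (by norm_num)
      _ = ell D ^ 2 := Real.rpow_natCast _ 2
  have h7 : (3 : ℝ) ^ 7 ≤ ell D ^ 7 := pow_le_pow_left₀ (by norm_num) hL 7
  have h9 : 5 * ell D ^ 2 ≤ ell D ^ 9 := by
    have e : ell D ^ 9 = ell D ^ 7 * ell D ^ 2 := by ring
    rw [e]; nlinarith [pow_nonneg hL0.le 2]
  rw [bigT, bigP, ← Real.exp_nat_mul]
  exact Real.exp_le_exp.mpr (by push_cast; nlinarith)

/-- For `𝓛 ≥ 3`: `2T² ≤ 2P₄` and `T³ ≤ 2P₄` (`P₄ = PT⁻²t₀ ≥ PT⁻²`, `T⁵ ≤ P`).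
[cite: Zhang2022LandauSiegel, §6 p.12] -/
theorem short_lengths_le_two_P4 (hL : 3 ≤ ell D) :
    2 * bigT D ^ 2 ≤ 2 * P4 D ∧ bigT D ^ 3 ≤ 2 * P4 D := by
  have hL1 : 1 ≤ ell D := by linarith
  have hT1 : 1 ≤ bigT D := by rw [bigT]; exact Real.one_le_exp (by positivity)
  have hT0 : 0 < bigT D := by linarith
  have hP0 : 0 < bigP D := Real.exp_pos _
  have ht1 : 1 ≤ t0 D := by rw [t0]; exact one_le_pow₀ hL1
  have h5 := bigT_pow_five_le_bigP hL
  have hPT : bigP D / bigT D ^ 2 ≤ P4 D := by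
    rw [P4]; exact le_mul_of_one_le_right (by positivity) ht1
  have hT2 : 0 < bigT D ^ 2 := by positivity
  have h4 : bigT D ^ 4 ≤ bigP D := le_trans (pow_le_pow_right₀ hT1 (by norm_num)) h5
  constructor
  · -- `T² ≤ P/T²`
    have h1 : bigT D ^ 2 ≤ bigP D / bigT D ^ 2 := by
      rw [le_div_iff₀ hT2]; nlinarith
    linarith [h1.trans hPT]
  · have h1 : bigT D ^ 3 ≤ bigP D / bigT D ^ 2 := by
      rw [le_div_iff₀ hT2]; nlinarith
    have h2 : 0 ≤ P4 D := by rw [P4]; positivity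
    linarith [h1.trans hPT]

/-- `(⌈a⌉ − 1)(⌈b⌉ − 1) ≤ ⌊2P₄⌋²` for `0 ≤ a, b ≤ 2P₄`. [folklore] -/
private theorem ceil_pred_mul_le {a b M : ℝ} (ha : a ≤ M) (hb : b ≤ M) :
    (⌈a⌉₊ - 1) * (⌈b⌉₊ - 1) ≤ ⌊M⌋₊ * ⌊M⌋₊ := by
  have h1 : ⌈a⌉₊ - 1 ≤ ⌊M⌋₊ :=
    le_trans (Nat.sub_le_of_le_add (Nat.ceil_le_floor_add_one a)) (Nat.floor_le_floor ha)
  have h2 : ⌈b⌉₊ - 1 ≤ ⌊M⌋₊ :=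
    le_trans (Nat.sub_le_of_le_add (Nat.ceil_le_floor_add_one b)) (Nat.floor_le_floor hb)
  exact Nat.mul_le_mul h1 h2

/-- **The three length conditions of the large sieve** (eventually in `D`): the products `K·K`, `N·K`
and `D_{T³}·K` have lengths `≤ ⌊P²⌋` (`(2P₄)² ≤ P²`, tree `Typed.Sec14.Eq143.floor_two_P4_sq_le`).
[cite: Zhang2022LandauSiegel, §7 (7.5) p.35; §6 Lemma 6.1] -/
theorem prod_lengths_eventually : ∃ D₀ : ℕ, ∀ D : ℕ, D₀ ≤ D →
    (⌈2 * P4 D⌉₊ - 1) * (⌈2 * P4 D⌉₊ - 1) ≤ ⌊bigP D ^ 2⌋₊ ∧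
      (⌈2 * bigT D ^ 2⌉₊ - 1) * (⌈2 * P4 D⌉₊ - 1) ≤ ⌊bigP D ^ 2⌋₊ ∧
      (⌈bigT D ^ 3⌉₊ - 1) * (⌈2 * P4 D⌉₊ - 1) ≤ ⌊bigP D ^ 2⌋₊ := by
  obtain ⟨D₀, hD₀⟩ := Typed.Sec14.Eq143.floor_two_P4_sq_le
  refine ⟨max D₀ ⌈Real.exp 3⌉₊, fun D hD => ?_⟩
  have hsq := hD₀ D (le_trans (le_max_left _ _) hD)
  have hL3 : 3 ≤ ell D := by
    have h1 : Real.exp 3 ≤ D :=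
      le_trans (Nat.le_ceil _) (by exact_mod_cast le_trans (le_max_right _ _) hD)
    have := Real.log_le_log (Real.exp_pos 3) h1
    rwa [Real.log_exp] at this
  obtain ⟨hN, hE⟩ := short_lengths_le_two_P4 hL3
  exact ⟨(ceil_pred_mul_le le_rfl le_rfl).trans hsq, (ceil_pred_mul_le hN le_rfl).trans hsq,
    (ceil_pred_mul_le hE le_rfl).trans hsq⟩

/-! ### The three large-sieve mean squares (products with `K`) -/

/-- **`Σ_{ψ∈T} |K(s+γ₁,ψ)K(s+γ₂,ψ)|² ≤ C₃₃e^{8π}m₄·P²·(log(⌊P²⌋+1))⁴`** for `|Re s − ½| ≤ 2α`,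
`Re γ₁, Re γ₂ ≥ 0`, `𝓛 ≥ 1`, lengths `(⌈2P₄⌉−1)² ≤ ⌊P²⌋` (Lemma 3.3 (ii) on the product polynomial).
[cite: Zhang2022LandauSiegel, §3 Lemma 3.3 p.14; §15 p.80] -/
theorem meanSq_Kchar_mul_Kchar_le (hL : 1 ≤ ell D) (T : Finset (Chr D)) {s γ₁ γ₂ : ℂ}
    (hs : |s.re - 1 / 2| ≤ 2 * alpha D) (hγ₁ : 0 ≤ γ₁.re) (hγ₂ : 0 ≤ γ₂.re)
    (hLM : (⌈2 * P4 D⌉₊ - 1) * (⌈2 * P4 D⌉₊ - 1) ≤ ⌊bigP D ^ 2⌋₊) :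
    ∑ x ∈ T, ‖Kchar D (psiFn x) (s + γ₁) * Kchar D (psiFn x) (s + γ₂)‖ ^ 2 ≤
      (2 + 2 * (3 + (Real.log 2 ^ 68)⁻¹) ^ 2) * Real.exp (8 * π) *
        majorantConst ((1 + 1) ^ 2) (2 * (1 + 1)) * (1 * 1) ^ 2 * bigP D ^ 2 *
          Real.log ((⌊bigP D ^ 2⌋₊ + 1 : ℕ) : ℝ) ^ ((1 + 1) ^ 2) := by
  have hL0 : 0 < ell D := by linarith
  simp_rw [Kchar_shift_eq_sum _ s γ₁, Kchar_shift_eq_sum _ s γ₂]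
  exact meanSq_mul_le_of_le_tau hL T hs zero_le_one (norm_Kchar_coeff_le hL0 hγ₁)
    (norm_Kchar_coeff_le hL0 hγ₂) hLM

/-- **`Σ_{ψ∈T} |N(s+β,ψ)K(s+γ,ψ)|² ≤ C₃₃e^{8π}m₄·P²·(log(⌊P²⌋+1))⁴`** for `|Re s − ½| ≤ 2α`, `Re β = 0`,
`Re γ ≥ 0`, lengths `(⌈2T²⌉−1)(⌈2P₄⌉−1) ≤ ⌊P²⌋`. [cite: Zhang2022LandauSiegel, §3 Lemma 3.3 p.14; §15 p.80] -/
theorem meanSq_Nchar_mul_Kchar_le (hL : 1 ≤ ell D) (T : Finset (Chr D)) {s β γ : ℂ}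
    (hs : |s.re - 1 / 2| ≤ 2 * alpha D) (hβ : β.re = 0) (hγ : 0 ≤ γ.re)
    (hLM : (⌈2 * bigT D ^ 2⌉₊ - 1) * (⌈2 * P4 D⌉₊ - 1) ≤ ⌊bigP D ^ 2⌋₊) :
    ∑ x ∈ T, ‖Nchar D (psiFn x) (s + β) * Kchar D (psiFn x) (s + γ)‖ ^ 2 ≤
      (2 + 2 * (3 + (Real.log 2 ^ 68)⁻¹) ^ 2) * Real.exp (8 * π) *
        majorantConst ((1 + 1) ^ 2) (2 * (1 + 1)) * (1 * 1) ^ 2 * bigP D ^ 2 *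
          Real.log ((⌊bigP D ^ 2⌋₊ + 1 : ℕ) : ℝ) ^ ((1 + 1) ^ 2) := by
  have hL0 : 0 < ell D := by linarith
  simp_rw [Nchar_shift_eq_sum _ s β, Kchar_shift_eq_sum _ s γ]
  exact meanSq_mul_le_of_le_tau hL T hs zero_le_one (norm_Nchar_coeff_le hL0 hβ)
    (norm_Kchar_coeff_le hL0 hγ) hLM

/-- **`Σ_{ψ∈T} |D_{T³}(s+γ₁,ψ)K(s+γ₂,ψ)|² ≤ C₃₃e^{8π}m₄·P²·(log(⌊P²⌋+1))⁴`** for `|Re s − ½| ≤ 2α`,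
`Re γ₁, Re γ₂ ≥ 0`, lengths `(⌈T³⌉−1)(⌈2P₄⌉−1) ≤ ⌊P²⌋` (`D_{T³}(w,ψ) = Σ_{n<T³}ψ(n)n^{−w}`, the polynomial of
`E₁`). [cite: Zhang2022LandauSiegel, §3 Lemma 3.3 p.14; §6 Lemma 6.1; §15 p.80] -/
theorem meanSq_dirPoly_mul_Kchar_le (hL : 1 ≤ ell D) (T : Finset (Chr D)) {s γ₁ γ₂ : ℂ}
    (hs : |s.re - 1 / 2| ≤ 2 * alpha D) (hγ₁ : 0 ≤ γ₁.re) (hγ₂ : 0 ≤ γ₂.re)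
    (hLM : (⌈bigT D ^ 3⌉₊ - 1) * (⌈2 * P4 D⌉₊ - 1) ≤ ⌊bigP D ^ 2⌋₊) :
    ∑ x ∈ T, ‖(∑ n ∈ Finset.Ico 1 ⌈bigT D ^ 3⌉₊, x.ψ (n : ZMod x.p) * (n : ℂ) ^ (-(s + γ₁))) *
        Kchar D (psiFn x) (s + γ₂)‖ ^ 2 ≤
      (2 + 2 * (3 + (Real.log 2 ^ 68)⁻¹) ^ 2) * Real.exp (8 * π) *
        majorantConst ((1 + 1) ^ 2) (2 * (1 + 1)) * (1 * 1) ^ 2 * bigP D ^ 2 *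
          Real.log ((⌊bigP D ^ 2⌋₊ + 1 : ℕ) : ℝ) ^ ((1 + 1) ^ 2) := by
  have hL0 : 0 < ell D := by linarith
  simp_rw [dirPoly_shift_eq_sum _ _ s γ₁, Kchar_shift_eq_sum _ s γ₂]
  exact meanSq_mul_le_of_le_tau hL T hs zero_le_one (norm_dirPoly_coeff_le hγ₁)
    (norm_Kchar_coeff_le hL0 hγ₂) hLM

/-! ### The two orthogonality mean squares (`K` and `B` alone, constant `𝔓`) -/

/-- **`Σ_{ψ∈T} |K(s+γ,ψ)|² ≤ e^{8π}·𝔓·(1 + log⌊P⌋)`** for `|Re s − ½| ≤ 2α`, `Re γ ≥ 0`, `𝓛 ≥ 1`, when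
`⌈2P₄⌉ − 1 ≤ ⌊P⌋` (Lemma 3.3 (i): the length `2P₄ < P` is below the moduli).
[cite: Zhang2022LandauSiegel, §3 Lemma 3.3 p.14; §15 p.80] -/
theorem meanSq_Kchar_le_frakP (hL : 1 ≤ ell D) (T : Finset (Chr D)) {s γ : ℂ}
    (hs : |s.re - 1 / 2| ≤ 2 * alpha D) (hγ : 0 ≤ γ.re) (hN : ⌈2 * P4 D⌉₊ - 1 ≤ ⌊bigP D⌋₊) :
    ∑ x ∈ T, ‖Kchar D (psiFn x) (s + γ)‖ ^ 2 ≤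
      Real.exp (8 * π) * frakP D * (1 + Real.log (⌊bigP D⌋₊ : ℕ)) := by
  have hL0 : 0 < ell D := by linarith
  set c : ℕ → ℂ := fun m => if m < ⌈2 * P4 D⌉₊ then (m : ℂ) ^ (-γ) * (gstar D (P4 D / m) : ℂ)
    else 0 with hc
  have hK : ∀ x : Chr D, Kchar D (psiFn x) (s + γ) =
      ∑ m ∈ Finset.Icc 1 ⌊bigP D⌋₊, c m * x.ψ (m : ZMod x.p) * (m : ℂ) ^ (-s) := by
    intro x
    rw [Kchar_shift_eq_sum x s γ]
    exact sum_Ico_eq_sum_Icc_trunc hN _ _ s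
  simp_rw [hK]
  have h1 := meanSq_floorP_le hL T hs c
  have hc1 : ∀ m, ‖c m‖ ≤ 1 := by
    intro m
    by_cases hm : m < ⌈2 * P4 D⌉₊
    · simp only [hc, if_pos hm]
      rcases Nat.eq_zero_or_pos m with h0 | hpos
      · subst h0
        rw [norm_mul]
        have hg := norm_gstar_le_one (D := D) hL0 (P4 D / (0 : ℕ))
        calc ‖((0 : ℕ) : ℂ) ^ (-γ)‖ * ‖(gstar D (P4 D / (0 : ℕ)) : ℂ)‖
            ≤ ‖((0 : ℕ) : ℂ) ^ (-γ)‖ * 1 := mul_le_mul_of_nonneg_left hg (norm_nonneg _)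
          _ ≤ 1 := by
              rw [mul_one, Nat.cast_zero]
              by_cases hz : (-γ) = 0
              · rw [hz, Complex.cpow_zero, norm_one]
              · rw [Complex.zero_cpow hz, norm_zero]; exact zero_le_one
      · have := norm_Kchar_coeff_le hL0 hγ m hpos.ne'
        rwa [tau_one_apply hpos.ne', mul_one] at this
    · simp only [hc, if_neg hm, norm_zero]; exact zero_le_one
  have h2 := sum_norm_sq_div_le_one_add_log hc1 ⌊bigP D⌋₊
  have hP : 0 ≤ Real.exp (8 * π) * frakP D := by
    have : 0 ≤ frakP D := by
      rw [frakP_eq_sum_primeWindow]; exact Finset.sum_nonneg fun p _ => Nat.cast_nonneg p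
    positivity
  exact h1.trans (mul_le_mul_of_nonneg_left h2 hP)

/-- **`Σ_{ψ∈T} |B(s,ψ)|² ≤ e^{8π}·m_B²m₄·𝔓·(log⌊P⌋)⁴`** for `|Re s − ½| ≤ 2α`, `𝓛 ≥ 3` (Lemma 3.3 (i):
`B` has length `PT⁻² < P`, below the moduli; `b ≪ τ₂` by (15.2); `Σ_{n≤X}τ₂(n)²/n ≪ (log X)⁴`) — the
orthogonality version of `Typed.Section13.meanSq_Bpoly_le`, with `𝔓` in place of `C₃₃P²`.
[cite: Zhang2022LandauSiegel, §3 Lemma 3.3 p.14; §15 (15.2) p.79] -/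
theorem meanSq_Bpoly_le_frakP [NeZero D] (χ : DirichletCharacter ℂ D) (hL : 3 ≤ ell D)
    (T : Finset (Chr D)) {s : ℂ} (hs : |s.re - 1 / 2| ≤ 2 * alpha D) :
    ∑ x ∈ T, ‖Bpoly χ x s‖ ^ 2 ≤
      Real.exp (8 * π) * frakP D *
        (((1 + ‖iota2‖) * (‖iota3‖ + ‖iota4‖)) ^ 2 *
          (majorantConst 4 4 * Real.log (⌊bigP D⌋₊ : ℕ) ^ 4)) := by
  have hL1 : 1 ≤ ell D := by linarith
  have hD2 : 2 ≤ Real.log D := by have h := hL; rw [ell] at h; linarith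
  obtain ⟨-, hPTP, hPT1, -⟩ := sizes_of_three_le hL
  have hP : 0 < bigP D := Real.exp_pos _
  -- `⌊P/T²⌋ + 1 − 1 ≤ ⌊P⌋` and `2 ≤ ⌊P⌋`
  have hN : ⌊bigP D / bigT D ^ 2⌋₊ + 1 - 1 ≤ ⌊bigP D⌋₊ := by
    rw [Nat.add_sub_cancel]
    exact Nat.floor_le_floor (by linarith)
  have hX : 2 ≤ ⌊bigP D⌋₊ := by
    have : (2 : ℝ) ≤ bigP D := by linarith
    exact Nat.le_floor (by exact_mod_cast this)
  set c : ℕ → ℂ := fun n => if n < ⌊bigP D / bigT D ^ 2⌋₊ + 1 then bcoef D n * χ (n : ZMod D)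
    else 0 with hc
  have hB : ∀ x : Chr D, Bpoly χ x s =
      ∑ n ∈ Finset.Icc 1 ⌊bigP D⌋₊, c n * x.ψ (n : ZMod x.p) * (n : ℂ) ^ (-s) := by
    intro x
    rw [Bpoly_eq_sum_Ico χ x hL s]
    have e : ∀ n, bcoef D n * pc χ x n * (n : ℂ) ^ (-s) =
        (bcoef D n * χ (n : ZMod D)) * x.ψ (n : ZMod x.p) * (n : ℂ) ^ (-s) := by
      intro n; rw [pc]; ring
    simp_rw [e]
    exact sum_Ico_eq_sum_Icc_trunc hN _ _ s
  simp_rw [hB]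
  have h1 := meanSq_floorP_le hL1 T hs c
  have hdom : Dom c ((1 + ‖iota2‖) * (‖iota3‖ + ‖iota4‖)) (tau 2) :=
    dom_trunc_of_dom (dom_bcoef_chi χ hD2) (by positivity) (fun n => tau_nonneg 2 n) _
  have h2 := sum_norm_sq_div_le_of_dom_tau_two hdom hX
  have hP' : 0 ≤ Real.exp (8 * π) * frakP D := by
    have : 0 ≤ frakP D := by
      rw [frakP_eq_sum_primeWindow]; exact Finset.sum_nonneg fun p _ => Nat.cast_nonneg p
    positivity
  exact h1.trans (mul_le_mul_of_nonneg_left h2 hP')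

end PartA


/-! ## Part B. The pointwise reduction of `‖M₁(s,ψ)‖` to `ψ`-twisted objects at `u = 1 − s̄` -/

section PartB

variable (c' : ℝ) {D : ℕ}

/-- `conj β₁ = −β₁` (`β₁ = ib₁`, `b₁` real). [cite: Zhang2022LandauSiegel, §2 (2.13)] -/
theorem conj_beta1 (D : ℕ) : conj (beta1 c' D) = -beta1 c' D := by
  rw [beta1]; simp only [map_mul, Complex.conj_I, Complex.conj_ofReal]; ring

/-- `conj β₂ = −β₂`. [cite: Zhang2022LandauSiegel, §2 (2.13)] -/
theorem conj_beta2 (D : ℕ) : conj (beta2 c' D) = -beta2 c' D := by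
  rw [beta2]; simp only [map_mul, map_ofNat, Complex.conj_I, Complex.conj_ofReal]; ring

/-- `conj β₃ = −β₃`. [cite: Zhang2022LandauSiegel, §2 (2.13)] -/
theorem conj_beta3 (D : ℕ) : conj (beta3 c' D) = -beta3 c' D := by
  rw [beta3]; simp only [map_mul, map_ofNat, Complex.conj_I, Complex.conj_ofReal]; ring

/-- `Re β₃ = 0`. [cite: Zhang2022LandauSiegel, §2 (2.13)] -/
theorem beta3_re (D : ℕ) : (beta3 c' D).re = 0 := by
  have h := congrArg Complex.re (conj_beta3 c' D)
  rw [Complex.conj_re, Complex.neg_re] at h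
  linarith

/-- `Re β₂ = 0`. [cite: Zhang2022LandauSiegel, §2 (2.13)] -/
theorem beta2_re (D : ℕ) : (beta2 c' D).re = 0 := by
  have h := congrArg Complex.re (conj_beta2 c' D)
  rw [Complex.conj_re, Complex.neg_re] at h
  linarith

/-- `|(pt₀)^{−β₃}| = 1` (positive base, purely imaginary exponent). [cite: Zhang2022LandauSiegel, §2 (2.13)] -/
theorem norm_pt0_cpow_neg_beta3 (x : Chr D) (hL : 0 < ell D) :
    ‖(((x.p : ℝ) * t0 D : ℝ) : ℂ) ^ (-beta3 c' D)‖ = 1 := by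
  have hpt : 0 < (x.p : ℝ) * t0 D := by
    have hp : (0 : ℝ) < x.p := by exact_mod_cast x.prime.pos
    have ht : 0 < t0 D := by rw [t0]; positivity
    exact mul_pos hp ht
  rw [Complex.norm_cpow_eq_rpow_re_of_pos hpt, Complex.neg_re, beta3_re, neg_zero, Real.rpow_zero]

/-- **The prefactor of `M₁` has modulus `≤ 1` on `σ = ½ − α`**: `|τ(χ)χ(p)ψ̄(D)(pt₀)^{−β₃}D^{s−1}| =
√D·D^{−½−α} = D^{−α} ≤ 1` (`|τ(χ)| = √D` for primitive `χ`). [cite: Zhang2022LandauSiegel, §15 p. 80; §2 (2.4)] -/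
theorem norm_prefactor_le_one [NeZero D] (χ : DirichletCharacter ℂ D) (hχ : χ.IsPrimitive)
    (x : Chr D) (hL : 0 < ell D) (hα : 0 ≤ alpha D) {s : ℂ} (hre : s.re = 1 / 2 - alpha D) :
    ‖GammaFactor.tau χ * χ (x.p : ZMod D) * conj (x.ψ (D : ZMod x.p)) *
        (((x.p : ℝ) * t0 D : ℝ) : ℂ) ^ (-beta3 c' D) * (D : ℂ) ^ (s - 1)‖ ≤ 1 := by
  have hD0 : 0 < D := Nat.pos_of_ne_zero (NeZero.ne D)
  have hDr : (0 : ℝ) < D := by exact_mod_cast hD0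
  have hD1 : (1 : ℝ) ≤ D := by exact_mod_cast hD0
  rw [norm_mul, norm_mul, norm_mul, norm_mul, Typed.Sec14.norm_tau_eq_sqrt χ hχ,
    norm_pt0_cpow_neg_beta3 c' x hL, Complex.norm_conj,
    Complex.norm_natCast_cpow_of_pos hD0, Complex.sub_re, Complex.one_re, hre]
  have hχ1 : ‖χ (x.p : ZMod D)‖ ≤ 1 := χ.norm_le_one _
  have hψ1 : ‖x.ψ (D : ZMod x.p)‖ ≤ 1 := x.ψ.norm_le_one _
  have hpow : Real.sqrt D * (D : ℝ) ^ (1 / 2 - alpha D - 1) = (D : ℝ) ^ (-alpha D) := by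
    rw [Real.sqrt_eq_rpow, ← Real.rpow_add hDr]; ring_nf
  have hle : (D : ℝ) ^ (-alpha D) ≤ 1 := Real.rpow_le_one_of_one_le_of_nonpos hD1 (by linarith)
  calc Real.sqrt D * ‖χ (x.p : ZMod D)‖ * ‖x.ψ (D : ZMod x.p)‖ * 1 * (D : ℝ) ^ (1 / 2 - alpha D - 1)
      ≤ Real.sqrt D * 1 * 1 * 1 * (D : ℝ) ^ (1 / 2 - alpha D - 1) := by
        gcongr
    _ = (D : ℝ) ^ (-alpha D) := by rw [mul_one, mul_one, mul_one, hpow]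
    _ ≤ 1 := hle

/-- `1 − s̄ = s + 2α` when `Re s = ½ − α` (the point `u` on `𝔍(+α)` above `s ∈ 𝔍(−α)`).
[cite: Zhang2022LandauSiegel, §15 p. 80] -/
theorem one_sub_conj_eq {s : ℂ} (hre : s.re = 1 / 2 - alpha D) :
    1 - conj s = s + ((2 * alpha D : ℝ) : ℂ) := by
  apply Complex.ext
  · simp [hre]; ring
  · simp

/-- **The reflected `L`-quotient in `ψ`-terms**: with `u = 1 − s̄`,
`|L(1−s−β₁,ψ̄)L(1−s−β₂,ψ̄)/L(1−s,ψ̄)| = |L(u+β₁,ψ)/L(u,ψ)|·|L(u+β₂,ψ)|` (`L(w,ψ̄) = conj L(w̄,ψ)`,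
`conj β_j = −β_j`). [cite: Zhang2022LandauSiegel, §15 p. 80; §13 p. 74] -/
theorem norm_reflectedQuot_eq (x : Chr D) (s : ℂ) :
    ‖x.ψ⁻¹.LFunction (1 - s - beta1 c' D) * x.ψ⁻¹.LFunction (1 - s - beta2 c' D) /
        x.ψ⁻¹.LFunction (1 - s)‖ =
      ‖x.ψ.LFunction (1 - conj s + beta1 c' D) / x.ψ.LFunction (1 - conj s)‖ *
        ‖x.ψ.LFunction (1 - conj s + beta2 c' D)‖ := by
  have h1 : conj (1 - s - beta1 c' D) = 1 - conj s + beta1 c' D := by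
    rw [map_sub, map_sub, map_one, conj_beta1]; ring
  have h2 : conj (1 - s - beta2 c' D) = 1 - conj s + beta2 c' D := by
    rw [map_sub, map_sub, map_one, conj_beta2]; ring
  have h0 : conj (1 - s) = 1 - conj s := by rw [map_sub, map_one]
  rw [LFunction_inv_conj x (1 - s - beta1 c' D), LFunction_inv_conj x (1 - s - beta2 c' D),
    LFunction_inv_conj x (1 - s), h1, h2, h0, norm_div, norm_mul, Complex.norm_conj,
    Complex.norm_conj, Complex.norm_conj, norm_div]
  ring

/-- `|K(1−s−β₃,ψ̄)| = |K(u+β₃,ψ)|` with `u = 1 − s̄` (`conj K(w,ψ) = K(w̄,ψ̄)`, `conj β₃ = −β₃`).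
[cite: Zhang2022LandauSiegel, §6 Lemma 6.1; §15 p. 80] -/
theorem norm_Kchar_psiBar_eq (x : Chr D) (s : ℂ) :
    ‖Kchar D (psiBarFn x) (1 - s - beta3 c' D)‖ = ‖Kchar D (psiFn x) (1 - conj s + beta3 c' D)‖ := by
  have h : conj (1 - conj s + beta3 c' D) = 1 - s - beta3 c' D := by
    rw [map_add, map_sub, map_one, Complex.conj_conj, conj_beta3]; ring
  rw [← h, ← conj_Kchar x, Complex.norm_conj]

/-- `|N(1−w,ψ̄)| = |N(1−w̄,ψ)|` (`conj N(w,ψ̄) = N(w̄,ψ)`). [cite: Zhang2022LandauSiegel, §6 Lemma 6.1] -/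
theorem norm_Nchar_psiBar_eq (x : Chr D) (w : ℂ) :
    ‖Nchar D (psiBarFn x) (1 - w)‖ = ‖Nchar D (psiFn x) (1 - conj w)‖ := by
  have h : conj (1 - w) = 1 - conj w := by rw [map_sub, map_one]
  rw [← Complex.norm_conj (Nchar D (psiBarFn x) (1 - w)), conj_Nchar_bar x, h]

/-- **Pointwise reduction of `M₁`**: for primitive `χ`, `ψ ∈ Ψ`, `Re s = ½ − α ≥ …`, with `u = 1 − s̄`:
`‖M₁(s,ψ)‖ ≤ ‖L(u+β₁,ψ)/L(u,ψ)‖·‖L(u+β₂,ψ)‖·‖B(s,ψ)‖·‖K(u+β₃,ψ)‖`. [cite: Zhang2022LandauSiegel, §15 p. 80] -/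
theorem norm_M1_le [NeZero D] (χ : DirichletCharacter ℂ D) (hχ : χ.IsPrimitive) (x : Chr D)
    (hL : 0 < ell D) (hα : 0 ≤ alpha D) {s : ℂ} (hre : s.re = 1 / 2 - alpha D) :
    ‖GammaFactor.tau χ * χ (x.p : ZMod D) * conj (x.ψ (D : ZMod x.p)) *
        (((x.p : ℝ) * t0 D : ℝ) : ℂ) ^ (-beta3 c' D) * (D : ℂ) ^ (s - 1) *
        (x.ψ⁻¹.LFunction (1 - s - beta1 c' D) * x.ψ⁻¹.LFunction (1 - s - beta2 c' D) /
          x.ψ⁻¹.LFunction (1 - s)) *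
        Bpoly χ x s * Kchar D (psiBarFn x) (1 - s - beta3 c' D)‖ ≤
      ‖x.ψ.LFunction (1 - conj s + beta1 c' D) / x.ψ.LFunction (1 - conj s)‖ *
        ‖x.ψ.LFunction (1 - conj s + beta2 c' D)‖ * ‖Bpoly χ x s‖ *
        ‖Kchar D (psiFn x) (1 - conj s + beta3 c' D)‖ := by
  rw [norm_mul, norm_mul, norm_mul, norm_reflectedQuot_eq c' x s, norm_Kchar_psiBar_eq c' x s]
  have hpre := norm_prefactor_le_one c' χ hχ x hL hα hre
  have h0 : 0 ≤ ‖x.ψ.LFunction (1 - conj s + beta1 c' D) / x.ψ.LFunction (1 - conj s)‖ *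
      ‖x.ψ.LFunction (1 - conj s + beta2 c' D)‖ := by positivity
  calc ‖GammaFactor.tau χ * χ (x.p : ZMod D) * conj (x.ψ (D : ZMod x.p)) *
          (((x.p : ℝ) * t0 D : ℝ) : ℂ) ^ (-beta3 c' D) * (D : ℂ) ^ (s - 1)‖ *
        (‖x.ψ.LFunction (1 - conj s + beta1 c' D) / x.ψ.LFunction (1 - conj s)‖ *
          ‖x.ψ.LFunction (1 - conj s + beta2 c' D)‖) * ‖Bpoly χ x s‖ *
        ‖Kchar D (psiFn x) (1 - conj s + beta3 c' D)‖
      ≤ 1 * (‖x.ψ.LFunction (1 - conj s + beta1 c' D) / x.ψ.LFunction (1 - conj s)‖ *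
          ‖x.ψ.LFunction (1 - conj s + beta2 c' D)‖) * ‖Bpoly χ x s‖ *
        ‖Kchar D (psiFn x) (1 - conj s + beta3 c' D)‖ := by
        gcongr
    _ = _ := by ring

end PartB

/-! ## Part C. The mean value over `ψ ∈ Ψ₁`: pointwise on `𝔍(−α)` -/

section PartC

variable {D : ℕ}

/-- `Im β₂ = b₂`. [cite: Zhang2022LandauSiegel, §2 (2.13)] -/
theorem beta2_im (c' : ℝ) (D : ℕ) : (beta2 c' D).im = b2 c' D := by
  rw [beta2, b2]; simp

/-- `E₁(s,ψ) ≥ 0` (an integral of a non-negative function over `[−𝓛²⁰, 𝓛²⁰]`, times `𝓛⁻⁶⁸ ≥ 0`).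
[cite: Zhang2022LandauSiegel, §6 Lemma 6.1] -/
theorem E1main_nonneg (x : Chr D) (hL : 0 ≤ ell D) (s : ℂ) : 0 ≤ E1main x s := by
  unfold E1main
  refine mul_nonneg (inv_nonneg.mpr (pow_nonneg hL 68)) ?_
  refine intervalIntegral.integral_nonneg (by linarith [pow_nonneg hL 20]) fun v _ => ?_
  exact mul_nonneg (norm_nonneg _) (Real.exp_nonneg _)

/-- `√X ≤ A` when `X ≤ A²` and `A ≥ 0`. [folklore] -/
private theorem sqrt_le_of_le_sq {X A : ℝ} (hA : 0 ≤ A) (h : X ≤ A ^ 2) : Real.sqrt X ≤ A := by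
  calc Real.sqrt X ≤ Real.sqrt (A ^ 2) := Real.sqrt_le_sqrt h
    _ = A := Real.sqrt_sq hA

/-- Cauchy–Schwarz with square bounds: `Σ f·g ≤ A·B` if `Σ f² ≤ A²`, `Σ g² ≤ B²`, `A, B ≥ 0`. [folklore] -/
private theorem sum_mul_le_of_sq_le {ι : Type*} (T : Finset ι) {f g : ι → ℝ} {A B : ℝ}
    (hA : 0 ≤ A) (hB : 0 ≤ B) (hf : ∑ i ∈ T, f i ^ 2 ≤ A ^ 2) (hg : ∑ i ∈ T, g i ^ 2 ≤ B ^ 2) :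
    ∑ i ∈ T, f i * g i ≤ A * B :=
  (Real.sum_mul_le_sqrt_mul_sqrt T f g).trans
    (mul_le_mul (sqrt_le_of_le_sq hA hf) (sqrt_le_of_le_sq hB hg) (Real.sqrt_nonneg _) hA)

/-- `L₀ ≤ log D` once `D ≥ ⌈exp L₀⌉₊`. [folklore] -/
private theorem le_ell_of_ceil_exp_le_β {L₀ : ℝ} {D : ℕ} (hD : ⌈Real.exp L₀⌉₊ ≤ D) :
    L₀ ≤ ell D := by
  have h : Real.exp L₀ ≤ D := le_trans (Nat.le_ceil _) (by exact_mod_cast hD)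
  exact (Real.le_log_iff_exp_le (lt_of_lt_of_le (Real.exp_pos _) h)).mpr h

/-- The sizes of `α` for `𝓛 ≥ 80`: `0 < α ≤ 1/100`. [cite: Zhang2022LandauSiegel, §2 (2.10)] -/
private theorem alpha_small (h80 : 80 ≤ ell D) : 0 < alpha D ∧ alpha D ≤ 1 / 100 := by
  have hL0 : 0 < ell D := by linarith
  have hα : alpha D = π / ell D ^ 9 := by rw [alpha, bigP, Real.log_exp]
  rw [hα]
  refine ⟨by positivity, ?_⟩
  rw [div_le_iff₀ (by positivity)]
  have h9 : (80 : ℝ) ^ 9 ≤ ell D ^ 9 := pow_le_pow_left₀ (by norm_num) h80 9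
  nlinarith [Real.pi_lt_four]

/-- `log(⌊P⌋) ≤ 𝓛⁹` and `1 ≤ ⌊P⌋` (`log P = 𝓛⁹`, `P ≥ 1`). [cite: Zhang2022LandauSiegel, §2 (2.6)] -/
private theorem log_floor_bigP_le (hL : 1 ≤ ell D) :
    Real.log (⌊bigP D⌋₊ : ℕ) ≤ ell D ^ 9 ∧ 1 ≤ ⌊bigP D⌋₊ := by
  have hP1 : 1 ≤ bigP D := by rw [bigP]; exact Real.one_le_exp (by positivity)
  have hfl : 1 ≤ ⌊bigP D⌋₊ := Nat.le_floor (by exact_mod_cast hP1)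
  refine ⟨?_, hfl⟩
  calc Real.log (⌊bigP D⌋₊ : ℕ) ≤ Real.log (bigP D) :=
        Real.log_le_log (by exact_mod_cast hfl) (Nat.floor_le (by linarith))
    _ = ell D ^ 9 := by rw [bigP, Real.log_exp]

/-- `2P₄ ≤ P` once `2𝓛⁵¹⁹ ≤ T` (`P₄ = PT⁻²t₀`, `t₀ = 𝓛⁵¹⁹`, `T ≥ 1`), hence `⌈2P₄⌉ − 1 ≤ ⌊P⌋`.
[cite: Zhang2022LandauSiegel, §2 (2.6), §6 p.12] -/
private theorem ceil_two_P4_pred_le_floor (hL : 1 ≤ ell D) (hT : 2 * ell D ^ 519 ≤ bigT D) :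
    ⌈2 * P4 D⌉₊ - 1 ≤ ⌊bigP D⌋₊ := by
  have hP0 : 0 < bigP D := Real.exp_pos _
  have hT1 : 1 ≤ bigT D := by rw [bigT]; exact Real.one_le_exp (by positivity)
  have h1 : 2 * ell D ^ 519 ≤ bigT D ^ 2 := hT.trans (by nlinarith)
  have h2P4 : 2 * P4 D ≤ bigP D := by
    rw [P4, t0, show 2 * (bigP D / bigT D ^ 2 * ell D ^ 519) = bigP D * (2 * ell D ^ 519) / bigT D ^ 2
      by ring, div_le_iff₀ (by positivity)]
    exact mul_le_mul_of_nonneg_left h1 hP0.le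
  exact le_trans (Nat.sub_le_of_le_add (Nat.ceil_le_floor_add_one _)) (Nat.floor_le_floor h2P4)

/-- **The split of `L(u+β₂,ψ)` by Lemma 6.1 (reflected form)** at `u = 1 − s̄`, `Re s = ½ − α`,
`|Im s − 2πt₀| ≤ 𝓛₁`: `|L(u+β₂,ψ)| ≤ |K(s+2α+β₂,ψ)| + e¹⁶|N(s+β₂,ψ)| + C₆⁺E₁(s+β₂,ψ) + C₆⁺`
(`|Z(u+β₂,ψ)| ≤ e¹⁶`, `N(1−u−β₂,ψ̄) = conj N(s+β₂,ψ)`, `e^{−c𝓛¹⁰} ≤ 1`, `C₆⁺ = max(C₆,0)`).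
[cite: Zhang2022LandauSiegel, §6 Lemma 6.1; §15 p. 80] -/
theorem norm_L_split_le (c' : ℝ) (x : Chr D) (hL3 : 3 ≤ ell D) (hα0 : 0 < alpha D)
    (hα100 : alpha D ≤ 1 / 100) (hb2 : |b2 c' D| ≤ 4 * alpha D) {s : ℂ}
    (hre : s.re = 1 / 2 - alpha D) (him : |s.im - 2 * π * t0 D| ≤ ell1 D) {C₆ c₆ : ℝ} (hc₆ : 0 < c₆)
    (h61 : ∀ w : ℂ, |w.re - 1 / 2| < 2 * alpha D → |w.im - 2 * π * t0 D| < ell1 D + 2 →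
      ‖x.ψ.LFunction w - Kchar D (psiFn x) w - GammaFactor.Zfac x.ψ w * Nchar D (psiBarFn x) (1 - w)‖ ≤
        C₆ * (E1main x (1 - conj w) + Real.exp (-c₆ * ell D ^ 10))) :
    ‖x.ψ.LFunction (1 - conj s + beta2 c' D)‖ ≤
      ‖Kchar D (psiFn x) (s + (((2 * alpha D : ℝ) : ℂ) + beta2 c' D))‖ +
        Real.exp 16 * ‖Nchar D (psiFn x) (s + beta2 c' D)‖ +
        max C₆ 0 * E1main x (s + beta2 c' D) + max C₆ 0 := by
  have hL0 : 0 < ell D := by linarith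
  have hu : 1 - conj s = s + ((2 * alpha D : ℝ) : ℂ) := one_sub_conj_eq hre
  obtain ⟨w, hw⟩ : ∃ w : ℂ, w = 1 - conj s + beta2 c' D := ⟨_, rfl⟩
  have hure : (1 - conj s).re = 1 / 2 + alpha D := by rw [hu]; simp [hre]; ring
  have huim : (1 - conj s).im = s.im := by rw [hu]; simp
  have hwre : w.re = 1 / 2 + alpha D := by rw [hw, Complex.add_re, hure, beta2_re, add_zero]
  have hwim : w.im = s.im + b2 c' D := by rw [hw, Complex.add_im, huim, beta2_im]
  have hw1 : |w.re - 1 / 2| < 2 * alpha D := by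
    rw [hwre, show 1 / 2 + alpha D - 1 / 2 = alpha D by ring, abs_of_pos hα0]; linarith
  have hw2' : |w.im - 2 * π * t0 D| ≤ ell1 D + 4 * alpha D := by
    rw [hwim]
    calc |s.im + b2 c' D - 2 * π * t0 D| = |(s.im - 2 * π * t0 D) + b2 c' D| := by ring_nf
      _ ≤ |s.im - 2 * π * t0 D| + |b2 c' D| := abs_add_le _ _
      _ ≤ ell1 D + 4 * alpha D := add_le_add him hb2
  have hw2 : |w.im - 2 * π * t0 D| < ell1 D + 2 := by linarith
  have h6 := h61 w hw1 hw2
  have hcw : 1 - conj w = s + beta2 c' D := by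
    rw [hw, map_add, map_sub, map_one, Complex.conj_conj, conj_beta2]; ring
  rw [hcw] at h6
  have hws : w = (((1 / 2 + alpha D : ℝ)) : ℂ) + (w.im : ℝ) * I :=
    Complex.ext (by simp [hwre]) (by simp)
  have hZ : ‖GammaFactor.Zfac x.ψ w‖ ≤ Real.exp 16 := by
    rw [hws]
    refine Section6Statements.norm_Zfac_le_exp_sixteen x hL3 ?_ ?_
    · rw [show 1 / 2 + alpha D - 1 / 2 = alpha D by ring, abs_of_pos hα0]; linarith
    · exact hw2
  have hN : ‖Nchar D (psiBarFn x) (1 - w)‖ = ‖Nchar D (psiFn x) (s + beta2 c' D)‖ := by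
    rw [norm_Nchar_psiBar_eq x w, hcw]
  have hKw : Kchar D (psiFn x) w = Kchar D (psiFn x) (s + (((2 * alpha D : ℝ) : ℂ) + beta2 c' D)) := by
    rw [hw, hu, add_assoc]
  have hE0 : 0 ≤ E1main x (s + beta2 c' D) := E1main_nonneg x hL0.le _
  have hε1 : Real.exp (-c₆ * ell D ^ 10) ≤ 1 := by
    rw [Real.exp_le_one_iff]
    have : 0 ≤ c₆ * ell D ^ 10 := by positivity
    linarith
  have hC : C₆ ≤ max C₆ 0 := le_max_left _ _
  have hC0 : 0 ≤ max C₆ 0 := le_max_right _ _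
  have h3 : x.ψ.LFunction w = (x.ψ.LFunction w - Kchar D (psiFn x) w -
      GammaFactor.Zfac x.ψ w * Nchar D (psiBarFn x) (1 - w)) + Kchar D (psiFn x) w +
        GammaFactor.Zfac x.ψ w * Nchar D (psiBarFn x) (1 - w) := by ring
  rw [← hw]
  calc ‖x.ψ.LFunction w‖
      = ‖(x.ψ.LFunction w - Kchar D (psiFn x) w -
          GammaFactor.Zfac x.ψ w * Nchar D (psiBarFn x) (1 - w)) + Kchar D (psiFn x) w +
          GammaFactor.Zfac x.ψ w * Nchar D (psiBarFn x) (1 - w)‖ := congrArg _ h3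
    _ ≤ ‖x.ψ.LFunction w - Kchar D (psiFn x) w -
          GammaFactor.Zfac x.ψ w * Nchar D (psiBarFn x) (1 - w)‖ + ‖Kchar D (psiFn x) w‖ +
          ‖GammaFactor.Zfac x.ψ w * Nchar D (psiBarFn x) (1 - w)‖ := norm_add₃_le
    _ ≤ C₆ * (E1main x (s + beta2 c' D) + Real.exp (-c₆ * ell D ^ 10)) + ‖Kchar D (psiFn x) w‖ +
          Real.exp 16 * ‖Nchar D (psiBarFn x) (1 - w)‖ := by
        refine add_le_add (add_le_add h6 le_rfl) ?_
        rw [norm_mul]; exact mul_le_mul_of_nonneg_right hZ (norm_nonneg _)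
    _ ≤ max C₆ 0 * (E1main x (s + beta2 c' D) + 1) + ‖Kchar D (psiFn x) w‖ +
          Real.exp 16 * ‖Nchar D (psiBarFn x) (1 - w)‖ := by
        have h1 : C₆ * (E1main x (s + beta2 c' D) + Real.exp (-c₆ * ell D ^ 10)) ≤
            max C₆ 0 * (E1main x (s + beta2 c' D) + 1) :=
          calc C₆ * (E1main x (s + beta2 c' D) + Real.exp (-c₆ * ell D ^ 10))
              ≤ max C₆ 0 * (E1main x (s + beta2 c' D) + Real.exp (-c₆ * ell D ^ 10)) :=
                mul_le_mul_of_nonneg_right hC (by positivity)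
            _ ≤ max C₆ 0 * (E1main x (s + beta2 c' D) + 1) := by gcongr
        linarith
    _ = _ := by rw [hN, hKw]; ring

/-- **The `E₁`-paired mean square**: for `𝓛 ≥ 3`, `|Re s − ½| ≤ 2α`, `Re γ ≥ 0` and lengths
`(⌈T³⌉−1)(⌈2P₄⌉−1) ≤ ⌊P²⌋`:
`Σ_{ψ∈T} (E₁(s+β₂,ψ)·|K(s+γ,ψ)|)² ≤ 4π·C₃₃e^{8π}m₄·P²·(log(⌊P²⌋+1))⁴` (Cauchy–Schwarz in `v` against
the Gaussian `Typed.Section13.sum_E1main_sq_mul_le`, the large sieve at each `s + β₂ + iv`,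
`∫e^{−v²/(4𝓛³⁰)} ≤ 2√π𝓛¹⁵`, and `𝓛³⁰ ≤ 𝓛¹³⁶`). [cite: Zhang2022LandauSiegel, §6 Lemma 6.1; §15 p. 80] -/
theorem meanSq_E1main_mul_Kchar_le (c' : ℝ) (hL3 : 3 ≤ ell D) (T : Finset (Chr D)) {s γ : ℂ}
    (hs : |s.re - 1 / 2| ≤ 2 * alpha D) (hγ : 0 ≤ γ.re)
    (hLM : (⌈bigT D ^ 3⌉₊ - 1) * (⌈2 * P4 D⌉₊ - 1) ≤ ⌊bigP D ^ 2⌋₊) :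
    ∑ x ∈ T, (E1main x (s + beta2 c' D) * ‖Kchar D (psiFn x) (s + γ)‖) ^ 2 ≤
      4 * π * ((2 + 2 * (3 + (Real.log 2 ^ 68)⁻¹) ^ 2) * Real.exp (8 * π) *
        majorantConst ((1 + 1) ^ 2) (2 * (1 + 1)) * (1 * 1) ^ 2 * bigP D ^ 2 *
          Real.log ((⌊bigP D ^ 2⌋₊ + 1 : ℕ) : ℝ) ^ ((1 + 1) ^ 2)) := by
  have hL1 : 1 ≤ ell D := by linarith
  have hL0 : 0 < ell D := by linarith
  set Lw : ℝ := ell D ^ 20 with hLw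
  set wt : ℝ → ℝ := fun v => Real.exp (-(v ^ 2) / (4 * ell D ^ 30)) with hwt
  set g : Chr D → ℝ := fun x => ‖Kchar D (psiFn x) (s + γ)‖ ^ 2 with hgdef
  have hg : ∀ x, 0 ≤ g x := fun x => sq_nonneg _
  have hred := sum_E1main_sq_mul_le T hL3 (s + beta2 c' D) g hg
  set W : ℝ := (2 + 2 * (3 + (Real.log 2 ^ 68)⁻¹) ^ 2) * Real.exp (8 * π) *
    majorantConst ((1 + 1) ^ 2) (2 * (1 + 1)) * (1 * 1) ^ 2 * bigP D ^ 2 *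
      Real.log ((⌊bigP D ^ 2⌋₊ + 1 : ℕ) : ℝ) ^ ((1 + 1) ^ 2) with hW
  have hW0 : 0 ≤ W := by
    rw [hW]
    exact mul_nonneg (mul_nonneg (mul_nonneg (mul_nonneg (mul_nonneg c33_nonneg
      (Real.exp_nonneg _)) (majorantConst_pos _ _).le) (sq_nonneg _)) (sq_nonneg _))
      (pow_nonneg (Real.log_natCast_nonneg _) _)
  have hpt : ∀ v : ℝ, ∑ x ∈ T, ‖∑ n ∈ Finset.Ico 1 ⌈bigT D ^ 3⌉₊,
      x.ψ (n : ZMod x.p) * (n : ℂ) ^ (-(s + beta2 c' D + v * I))‖ ^ 2 * g x ≤ W := by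
    intro v
    have hγv : 0 ≤ (beta2 c' D + v * I).re := by simp [beta2_re]
    have h := meanSq_dirPoly_mul_Kchar_le hL1 T hs hγv hγ hLM
    rw [← hW] at h
    refine le_of_eq_of_le ?_ h
    refine Finset.sum_congr rfl fun x _ => ?_
    rw [hgdef, ← mul_pow, ← norm_mul, show s + beta2 c' D + v * I = s + (beta2 c' D + v * I) by ring]
  have hwtc : Continuous wt := by rw [hwt]; exact Real.continuous_exp.comp (by fun_prop)
  have hwt0 : ∀ v, 0 ≤ wt v := fun v => (Real.exp_pos _).le
  have hcont : Continuous fun v : ℝ => ∑ x ∈ T, ‖∑ n ∈ Finset.Ico 1 ⌈bigT D ^ 3⌉₊,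
      x.ψ (n : ZMod x.p) * (n : ℂ) ^ (-(s + beta2 c' D + v * I))‖ ^ 2 * g x :=
    continuous_finsetSum _ fun x _ =>
      ((continuous_norm_dirPoly_shift x (s + beta2 c' D) _).pow 2).mul continuous_const
  have hint : ∫ v in (-Lw)..Lw, (∑ x ∈ T, ‖∑ n ∈ Finset.Ico 1 ⌈bigT D ^ 3⌉₊,
      x.ψ (n : ZMod x.p) * (n : ℂ) ^ (-(s + beta2 c' D + v * I))‖ ^ 2 * g x) * wt v ≤
      W * (2 * Real.sqrt π * ell D ^ 15) := by
    calc ∫ v in (-Lw)..Lw, (∑ x ∈ T, ‖∑ n ∈ Finset.Ico 1 ⌈bigT D ^ 3⌉₊,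
          x.ψ (n : ZMod x.p) * (n : ℂ) ^ (-(s + beta2 c' D + v * I))‖ ^ 2 * g x) * wt v
        ≤ ∫ v in (-Lw)..Lw, W * wt v := by
          refine intervalIntegral.integral_mono_on (by rw [hLw]; linarith [pow_nonneg hL0.le 20])
            ((hcont.mul hwtc).intervalIntegrable _ _)
            ((continuous_const.mul hwtc).intervalIntegrable _ _) fun v _ => ?_
          exact mul_le_mul_of_nonneg_right (hpt v) (hwt0 v)
      _ = W * ∫ v in (-Lw)..Lw, wt v := by rw [intervalIntegral.integral_const_mul]
      _ ≤ W * (2 * Real.sqrt π * ell D ^ 15) :=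
          mul_le_mul_of_nonneg_left (integral_gaussWeight_le hL0 (by positivity)) hW0
  have hkey : ∑ x ∈ T, (E1main x (s + beta2 c' D) * ‖Kchar D (psiFn x) (s + γ)‖) ^ 2 =
      ∑ x ∈ T, E1main x (s + beta2 c' D) ^ 2 * g x := by
    refine Finset.sum_congr rfl fun x _ => ?_
    rw [hgdef, mul_pow]
  rw [hkey]
  have hℓ136 : (ell D ^ 68)⁻¹ ^ 2 * (2 * Real.sqrt π * ell D ^ 15) * (W * (2 * Real.sqrt π * ell D ^ 15))
      ≤ 4 * π * W := by
    have hsq : Real.sqrt π ^ 2 = π := Real.sq_sqrt Real.pi_pos.le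
    have hL68 : (1 : ℝ) ≤ ell D ^ 106 := one_le_pow₀ hL1
    have hne : ell D ^ 68 ≠ 0 := by positivity
    have e : (ell D ^ 68)⁻¹ ^ 2 * (2 * Real.sqrt π * ell D ^ 15) * (W * (2 * Real.sqrt π * ell D ^ 15))
        = 4 * Real.sqrt π ^ 2 * W * (ell D ^ 30 / ell D ^ 136) := by
      field_simp; ring
    rw [e, hsq]
    have hfrac : ell D ^ 30 / ell D ^ 136 ≤ 1 := by
      rw [div_le_one (by positivity)]
      calc ell D ^ 30 = ell D ^ 30 * 1 := (mul_one _).symm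
        _ ≤ ell D ^ 30 * ell D ^ 106 := mul_le_mul_of_nonneg_left hL68 (by positivity)
        _ = ell D ^ 136 := by ring
    calc 4 * π * W * (ell D ^ 30 / ell D ^ 136) ≤ 4 * π * W * 1 :=
          mul_le_mul_of_nonneg_left hfrac (by positivity)
      _ = 4 * π * W := mul_one _
  exact hred.trans ((mul_le_mul_of_nonneg_left hint (by positivity)).trans hℓ136)

/-- `(9√Q·P·L¹⁸)² = 81·Q·P²·L³⁶` for `Q ≥ 0`. [folklore] -/
private theorem sq_scaleA (Q P L : ℝ) (hQ : 0 ≤ Q) :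
    (9 * Real.sqrt Q * P * L ^ 18) ^ 2 = 81 * Q * P ^ 2 * L ^ 36 := by
  rw [show (9 * Real.sqrt Q * P * L ^ 18) ^ 2 = 81 * Real.sqrt Q ^ 2 * P ^ 2 * (L ^ 18) ^ 2 by ring,
    Real.sq_sqrt hQ]; ring

/-- `(e·m·√M·√F·L¹⁸)² = e²·m²·M·F·L³⁶` for `M, F ≥ 0`. [folklore] -/
private theorem sq_scaleB (e m M F L : ℝ) (hM : 0 ≤ M) (hF : 0 ≤ F) :
    (e * m * Real.sqrt M * Real.sqrt F * L ^ 18) ^ 2 = e ^ 2 * m ^ 2 * M * F * L ^ 36 := by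
  rw [show (e * m * Real.sqrt M * Real.sqrt F * L ^ 18) ^ 2 =
      e ^ 2 * m ^ 2 * Real.sqrt M ^ 2 * Real.sqrt F ^ 2 * (L ^ 18) ^ 2 by ring,
    Real.sq_sqrt hM, Real.sq_sqrt hF]; ring

/-- `(2√π·A)² = 4π·A²`. [folklore] -/
private theorem sq_scaleE (A : ℝ) : (2 * Real.sqrt π * A) ^ 2 = 4 * π * A ^ 2 := by
  rw [show (2 * Real.sqrt π * A) ^ 2 = 4 * Real.sqrt π ^ 2 * A ^ 2 by ring,
    Real.sq_sqrt Real.pi_pos.le]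

/-- **The final Cauchy–Schwarz bookkeeping** (pure real algebra): if, for non-negative weights on a finite
set, `M(ψ) ≤ Λ·(a(ψ)k(ψ)b(ψ) + e·n(ψ)k(ψ)b(ψ) + C·E(ψ)k(ψ)b(ψ) + C·k(ψ)b(ψ))` and the four mean squares
`Σ(ak)², Σ(nk)² ≤ A²`, `Σ(Ek)² ≤ (2√πA)²`, `Σk² ≤ K²`, `Σb² ≤ B²`, then
`ΣM ≤ Λ·((1+e+2√πC)A + CK)·B`. [folklore] -/
private theorem assembly_le {ι : Type*} (T : Finset ι) {M a n E k b : ι → ℝ} {Λ e C A K B : ℝ}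
    (hΛ : 0 ≤ Λ) (he : 0 ≤ e) (hC : 0 ≤ C) (hA : 0 ≤ A) (hK : 0 ≤ K) (hB : 0 ≤ B)
    (hM : ∀ i ∈ T, M i ≤ Λ * (a i * k i * b i + e * (n i * k i * b i) + C * (E i * k i * b i) +
      C * (k i * b i)))
    (hak : ∑ i ∈ T, (a i * k i) ^ 2 ≤ A ^ 2) (hnk : ∑ i ∈ T, (n i * k i) ^ 2 ≤ A ^ 2)
    (hEk : ∑ i ∈ T, (E i * k i) ^ 2 ≤ (2 * Real.sqrt π * A) ^ 2) (hk : ∑ i ∈ T, k i ^ 2 ≤ K ^ 2)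
    (hb : ∑ i ∈ T, b i ^ 2 ≤ B ^ 2) :
    ∑ i ∈ T, M i ≤ Λ * ((1 + e + 2 * Real.sqrt π * C) * A + C * K) * B := by
  have h1 : ∑ i ∈ T, (a i * k i) * b i ≤ A * B := sum_mul_le_of_sq_le T hA hB hak hb
  have h2 : ∑ i ∈ T, (n i * k i) * b i ≤ A * B := sum_mul_le_of_sq_le T hA hB hnk hb
  have h3 : ∑ i ∈ T, (E i * k i) * b i ≤ (2 * Real.sqrt π * A) * B :=
    sum_mul_le_of_sq_le T (by positivity) hB hEk hb
  have h4 : ∑ i ∈ T, k i * b i ≤ K * B := sum_mul_le_of_sq_le T hK hB hk hb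
  calc ∑ i ∈ T, M i
      ≤ ∑ i ∈ T, Λ * (a i * k i * b i + e * (n i * k i * b i) + C * (E i * k i * b i) +
          C * (k i * b i)) := Finset.sum_le_sum hM
    _ = Λ * (∑ i ∈ T, (a i * k i) * b i + e * ∑ i ∈ T, (n i * k i) * b i +
          C * ∑ i ∈ T, (E i * k i) * b i + C * ∑ i ∈ T, k i * b i) := by
        rw [← Finset.mul_sum, Finset.sum_add_distrib, Finset.sum_add_distrib, Finset.sum_add_distrib,
          ← Finset.mul_sum, ← Finset.mul_sum, ← Finset.mul_sum]
    _ ≤ Λ * (A * B + e * (A * B) + C * ((2 * Real.sqrt π * A) * B) + C * (K * B)) := by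
        gcongr
    _ = Λ * ((1 + e + 2 * Real.sqrt π * C) * A + C * K) * B := by ring

/-- **(β), POINTWISE on `𝔍(−α)`**: for `c′ ≥ 0` with Prop. 2.2, there is `C ≥ 0` such that for all large
`D`, under (A), for every `s ∈ 𝔍(−α)`,
`Σ_{ψ∈Ψ₁} ‖M₁(s,ψ)‖ ≤ C·P·√𝔓·𝓛⁴⁵` (`M₁` the main term of `step15_u008alpha_holds`, same term order).
[cite: Zhang2022LandauSiegel, §15 p. 80, tex L4020] -/
theorem sum_norm_M1_le_of_prop22 {c' : ℝ} (hc' : 0 ≤ c') (h22 : Prop22 c') :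
    ∃ C : ℝ, 0 ≤ C ∧ ForAllLarge fun D _ χ => AssumptionA D χ → ∀ s : ℂ, MemJ D (-alpha D) s →
      ∑ x ∈ finsetOf (PsiOne χ),
        ‖GammaFactor.tau χ * χ (x.p : ZMod D) * conj (x.ψ (D : ZMod x.p)) *
            (((x.p : ℝ) * t0 D : ℝ) : ℂ) ^ (-beta3 c' D) * (D : ℂ) ^ (s - 1) *
            (x.ψ⁻¹.LFunction (1 - s - beta1 c' D) * x.ψ⁻¹.LFunction (1 - s - beta2 c' D) /
              x.ψ⁻¹.LFunction (1 - s)) *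
            Bpoly χ x s * Kchar D (psiBarFn x) (1 - s - beta3 c' D)‖ ≤
        C * bigP D * Real.sqrt (frakP D) * ell D ^ 45 := by
  obtain ⟨C₅₉, D₅₉, h59⟩ := lemma59_restricted_of_prop22 hc' h22 1 one_pos
  obtain ⟨c₆, hc₆, C₆, D₆, h61⟩ := Section6Statements.lemma61_reflected
  obtain ⟨D₂₂, h22i⟩ := h22.1
  obtain ⟨Dℓ, hℓ⟩ := prod_lengths_eventually
  obtain ⟨DT, hT⟩ := Typed.Sec14.Eq143.pow_le_bigT 519 2
  obtain ⟨DP, hPfr⟩ := frakP_le_two_mul_bigP_sq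
  -- constants
  have hQ0 : 0 ≤ (2 + 2 * (3 + (Real.log 2 ^ 68)⁻¹) ^ 2) * Real.exp (8 * π) *
      majorantConst ((1 + 1) ^ 2) (2 * (1 + 1)) * (1 * 1) ^ 2 :=
    mul_nonneg (mul_nonneg (mul_nonneg c33_nonneg (Real.exp_nonneg _))
      (majorantConst_pos _ _).le) (sq_nonneg _)
  have hC₅0 : 0 ≤ max C₅₉ 0 := le_max_right _ _
  have hC₆0 : 0 ≤ max C₆ 0 := le_max_right _ _
  refine ⟨max C₅₉ 0 * ((1 + Real.exp 16 + 2 * Real.sqrt π * max C₆ 0) *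
      (9 * Real.sqrt ((2 + 2 * (3 + (Real.log 2 ^ 68)⁻¹) ^ 2) * Real.exp (8 * π) *
        majorantConst ((1 + 1) ^ 2) (2 * (1 + 1)) * (1 * 1) ^ 2)) + max C₆ 0 * (2 * Real.exp (4 * π))) *
      (Real.exp (4 * π) * ((1 + ‖iota2‖) * (‖iota3‖ + ‖iota4‖)) * Real.sqrt (majorantConst 4 4)),
    by positivity,
    max (max (max D₅₉ D₆) (max D₂₂ Dℓ)) (max (max DT DP) ⌈Real.exp (max 80 (5 * π * |c'| + 1))⌉₊), ?_⟩
  intro D _ χ hD hq hp hA s hs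
  -- thresholds
  have hD₅₉ : D₅₉ ≤ D := le_trans (le_trans (le_trans (le_max_left _ _) (le_max_left _ _)) (le_max_left _ _)) hD
  have hD₆ : D₆ ≤ D := le_trans (le_trans (le_trans (le_max_right _ _) (le_max_left _ _)) (le_max_left _ _)) hD
  have hD₂₂ : D₂₂ ≤ D := le_trans (le_trans (le_trans (le_max_left _ _) (le_max_right _ _)) (le_max_left _ _)) hD
  have hDℓ : Dℓ ≤ D := le_trans (le_trans (le_trans (le_max_right _ _) (le_max_right _ _)) (le_max_left _ _)) hD
  have hDT : DT ≤ D := le_trans (le_trans (le_trans (le_max_left _ _) (le_max_left _ _)) (le_max_right _ _)) hD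
  have hDP : DP ≤ D := le_trans (le_trans (le_trans (le_max_right _ _) (le_max_left _ _)) (le_max_right _ _)) hD
  have hLmax : max 80 (5 * π * |c'| + 1) ≤ ell D :=
    le_ell_of_ceil_exp_le_β (le_trans (le_max_right _ _) (le_trans (le_max_right _ _) hD))
  have h80 : 80 ≤ ell D := le_trans (le_max_left _ _) hLmax
  have hLc : 5 * π * |c'| + 1 ≤ ell D := le_trans (le_max_right _ _) hLmax
  have hL3 : 3 ≤ ell D := by linarith
  have hL1 : 1 ≤ ell D := by linarith
  have hL0 : 0 < ell D := by linarith
  obtain ⟨hα0, hα100⟩ := alpha_small h80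
  have hα4 : alpha D ≤ 1 / 4 := by linarith
  obtain ⟨-, hb2, -, -, -, -⟩ := Section8aStatements.shift_sizes_of_ell h80 hLc
  obtain ⟨hℓKK, hℓNK, hℓEK⟩ := hℓ D hDℓ
  have hlogP := log_floor_bigP_le (D := D) hL1
  have hlog2 : Real.log ((⌊bigP D ^ 2⌋₊ + 1 : ℕ) : ℝ) ≤ 3 * ell D ^ 9 :=
    (product_lengths_of_three_le hL3).2.2
  have hNK := ceil_two_P4_pred_le_floor hL1 (hT D hDT)
  have hP0 : 0 < bigP D := Real.exp_pos _
  -- the point `s ∈ 𝔍(−α)` and `u = 1 − s̄ = s + 2α`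
  have hre : s.re = 1 / 2 - alpha D := by rw [hs.1]; ring
  have him : |s.im - 2 * π * t0 D| ≤ ell1 D := hs.2
  have hs2 : |s.re - 1 / 2| ≤ 2 * alpha D := by
    rw [hre, show 1 / 2 - alpha D - 1 / 2 = -alpha D by ring, abs_neg, abs_of_pos hα0]; linarith
  have hu : 1 - conj s = s + ((2 * alpha D : ℝ) : ℂ) := one_sub_conj_eq hre
  have hure : (1 - conj s).re = 1 / 2 + alpha D := by rw [hu]; simp [hre]; ring
  have huim : (1 - conj s).im = s.im := by rw [hu]; simp
  have hγ₂re : 0 ≤ (((2 * alpha D : ℝ) : ℂ) + beta2 c' D).re := by simp [beta2_re]; linarith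
  have hγ₃re : 0 ≤ (((2 * alpha D : ℝ) : ℂ) + beta3 c' D).re := by simp [beta3_re]; linarith
  have hu3 : 1 - conj s + beta3 c' D = s + (((2 * alpha D : ℝ) : ℂ) + beta3 c' D) := by
    rw [hu, add_assoc]
  have hxmem : ∀ x ∈ finsetOf (PsiOne χ), x ∈ PsiOne χ := fun x hx => mem_of_mem_finsetOf hx
  -- (1) Lemma 5.9 at `u`, (2) Lemma 6.1 at `u + β₂`, (3) the pointwise bound for each `ψ ∈ Ψ₁`
  have hpt : ∀ x ∈ finsetOf (PsiOne χ),
      ‖GammaFactor.tau χ * χ (x.p : ZMod D) * conj (x.ψ (D : ZMod x.p)) *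
            (((x.p : ℝ) * t0 D : ℝ) : ℂ) ^ (-beta3 c' D) * (D : ℂ) ^ (s - 1) *
            (x.ψ⁻¹.LFunction (1 - s - beta1 c' D) * x.ψ⁻¹.LFunction (1 - s - beta2 c' D) /
              x.ψ⁻¹.LFunction (1 - s)) *
            Bpoly χ x s * Kchar D (psiBarFn x) (1 - s - beta3 c' D)‖ ≤
        (max C₅₉ 0 * ell D ^ 9) *
          (‖Kchar D (psiFn x) (s + (((2 * alpha D : ℝ) : ℂ) + beta2 c' D))‖ *
              ‖Kchar D (psiFn x) (s + (((2 * alpha D : ℝ) : ℂ) + beta3 c' D))‖ * ‖Bpoly χ x s‖ +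
            Real.exp 16 * (‖Nchar D (psiFn x) (s + beta2 c' D)‖ *
              ‖Kchar D (psiFn x) (s + (((2 * alpha D : ℝ) : ℂ) + beta3 c' D))‖ * ‖Bpoly χ x s‖) +
            max C₆ 0 * (E1main x (s + beta2 c' D) *
              ‖Kchar D (psiFn x) (s + (((2 * alpha D : ℝ) : ℂ) + beta3 c' D))‖ * ‖Bpoly χ x s‖) +
            max C₆ 0 * (‖Kchar D (psiFn x) (s + (((2 * alpha D : ℝ) : ℂ) + beta3 c' D))‖ *
              ‖Bpoly χ x s‖)) := by
    intro x hx
    have hx' := hxmem x hx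
    -- Lemma 5.9
    have hσ : |(1 - conj s).re - 1 / 2| = alpha D := by
      rw [hure, show 1 / 2 + alpha D - 1 / 2 = alpha D by ring, abs_of_pos hα0]
    have hclear := Section8aStatements.clearance_of_prop22i (h22i D χ hD₂₂ hq hp x hx') hα4 hσ
      (by rw [huim]; linarith)
    have hR := h59 D χ hD₅₉ hq hp x hx' (1 - conj s) hσ.le (by rw [huim]; linarith)
      (fun ρ hρ => by rw [one_mul]; exact hclear ρ hρ)
    rw [bigP, Real.log_exp] at hR
    have hR' : ‖x.ψ.LFunction (1 - conj s + beta1 c' D) / x.ψ.LFunction (1 - conj s)‖ ≤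
        max C₅₉ 0 * ell D ^ 9 :=
      hR.trans (mul_le_mul_of_nonneg_right (le_max_left _ _) (by positivity))
    -- Lemma 6.1
    have hL2 := norm_L_split_le c' x hL3 hα0 hα100 hb2 hre him hc₆ (h61 D χ hD₆ hq hp hA x)
    -- combine
    have h1 := norm_M1_le c' χ hp x hL0 hα0.le hre
    rw [hu3] at h1
    refine h1.trans ?_
    have hb0 : 0 ≤ ‖Bpoly χ x s‖ := norm_nonneg _
    have hk0 : 0 ≤ ‖Kchar D (psiFn x) (s + (((2 * alpha D : ℝ) : ℂ) + beta3 c' D))‖ := norm_nonneg _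
    have hR0 : 0 ≤ ‖x.ψ.LFunction (1 - conj s + beta1 c' D) / x.ψ.LFunction (1 - conj s)‖ :=
      norm_nonneg _
    calc ‖x.ψ.LFunction (1 - conj s + beta1 c' D) / x.ψ.LFunction (1 - conj s)‖ *
          ‖x.ψ.LFunction (1 - conj s + beta2 c' D)‖ * ‖Bpoly χ x s‖ *
          ‖Kchar D (psiFn x) (s + (((2 * alpha D : ℝ) : ℂ) + beta3 c' D))‖
        ≤ (max C₅₉ 0 * ell D ^ 9) *
          (‖Kchar D (psiFn x) (s + (((2 * alpha D : ℝ) : ℂ) + beta2 c' D))‖ +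
            Real.exp 16 * ‖Nchar D (psiFn x) (s + beta2 c' D)‖ +
            max C₆ 0 * E1main x (s + beta2 c' D) + max C₆ 0) * ‖Bpoly χ x s‖ *
          ‖Kchar D (psiFn x) (s + (((2 * alpha D : ℝ) : ℂ) + beta3 c' D))‖ := by
          gcongr
      _ = _ := by ring
  -- (4) the five mean squares, as squares in the scales `A = 9√Q·P·𝓛¹⁸`, `K = 2e^{4π}P𝓛¹⁸`,
  --     `B = e^{4π}m_B√m₄·√𝔓·𝓛¹⁸`
  have hfrakP0 : 0 ≤ frakP D := by
    rw [frakP_eq_sum_primeWindow]; exact Finset.sum_nonneg fun p _ => Nat.cast_nonneg p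
  have hLg : Real.log ((⌊bigP D ^ 2⌋₊ + 1 : ℕ) : ℝ) ^ ((1 + 1) ^ 2) ≤ 81 * ell D ^ 36 := by
    have h0 : 0 ≤ Real.log ((⌊bigP D ^ 2⌋₊ + 1 : ℕ) : ℝ) := Real.log_natCast_nonneg _
    calc Real.log ((⌊bigP D ^ 2⌋₊ + 1 : ℕ) : ℝ) ^ ((1 + 1) ^ 2) ≤ (3 * ell D ^ 9) ^ ((1 + 1) ^ 2) :=
          pow_le_pow_left₀ h0 hlog2 _
      _ = 81 * ell D ^ 36 := by norm_num; ring
  have he8 : Real.exp (4 * π) ^ 2 = Real.exp (8 * π) := by rw [← Real.exp_nat_mul]; ring_nf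
  have hAsq : (2 + 2 * (3 + (Real.log 2 ^ 68)⁻¹) ^ 2) * Real.exp (8 * π) *
      majorantConst ((1 + 1) ^ 2) (2 * (1 + 1)) * (1 * 1) ^ 2 * bigP D ^ 2 *
        Real.log ((⌊bigP D ^ 2⌋₊ + 1 : ℕ) : ℝ) ^ ((1 + 1) ^ 2) ≤
      (9 * Real.sqrt ((2 + 2 * (3 + (Real.log 2 ^ 68)⁻¹) ^ 2) * Real.exp (8 * π) *
        majorantConst ((1 + 1) ^ 2) (2 * (1 + 1)) * (1 * 1) ^ 2) * bigP D * ell D ^ 18) ^ 2 := by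
    rw [sq_scaleA _ _ _ hQ0]
    calc (2 + 2 * (3 + (Real.log 2 ^ 68)⁻¹) ^ 2) * Real.exp (8 * π) *
          majorantConst ((1 + 1) ^ 2) (2 * (1 + 1)) * (1 * 1) ^ 2 * bigP D ^ 2 *
          Real.log ((⌊bigP D ^ 2⌋₊ + 1 : ℕ) : ℝ) ^ ((1 + 1) ^ 2)
        ≤ (2 + 2 * (3 + (Real.log 2 ^ 68)⁻¹) ^ 2) * Real.exp (8 * π) *
          majorantConst ((1 + 1) ^ 2) (2 * (1 + 1)) * (1 * 1) ^ 2 * bigP D ^ 2 * (81 * ell D ^ 36) :=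
          mul_le_mul_of_nonneg_left hLg (by positivity)
      _ = _ := by ring
  have hSKK := (meanSq_Kchar_mul_Kchar_le hL1 (finsetOf (PsiOne χ)) hs2 hγ₂re hγ₃re hℓKK).trans hAsq
  have hSNK := (meanSq_Nchar_mul_Kchar_le hL1 (finsetOf (PsiOne χ)) hs2 (beta2_re c' D) hγ₃re
    hℓNK).trans hAsq
  have hSEK : ∑ x ∈ finsetOf (PsiOne χ), (E1main x (s + beta2 c' D) *
      ‖Kchar D (psiFn x) (s + (((2 * alpha D : ℝ) : ℂ) + beta3 c' D))‖) ^ 2 ≤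
      (2 * Real.sqrt π * (9 * Real.sqrt ((2 + 2 * (3 + (Real.log 2 ^ 68)⁻¹) ^ 2) * Real.exp (8 * π) *
        majorantConst ((1 + 1) ^ 2) (2 * (1 + 1)) * (1 * 1) ^ 2) * bigP D * ell D ^ 18)) ^ 2 := by
    refine (meanSq_E1main_mul_Kchar_le c' hL3 (finsetOf (PsiOne χ)) hs2 hγ₃re hℓEK).trans ?_
    rw [sq_scaleE]
    exact mul_le_mul_of_nonneg_left hAsq (by positivity)
  have hSK : ∑ x ∈ finsetOf (PsiOne χ), ‖Kchar D (psiFn x) (s + (((2 * alpha D : ℝ) : ℂ) + beta3 c' D))‖ ^ 2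
      ≤ (2 * Real.exp (4 * π) * bigP D * ell D ^ 18) ^ 2 := by
    refine (meanSq_Kchar_le_frakP hL1 (finsetOf (PsiOne χ)) hs2 hγ₃re hNK).trans ?_
    have h1 : 1 + Real.log (⌊bigP D⌋₊ : ℕ) ≤ 2 * ell D ^ 36 := by
      have : ell D ^ 9 ≤ ell D ^ 36 := pow_le_pow_right₀ hL1 (by norm_num)
      have : (1 : ℝ) ≤ ell D ^ 36 := one_le_pow₀ hL1
      linarith [hlogP.1]
    have h0 : 0 ≤ 1 + Real.log (⌊bigP D⌋₊ : ℕ) := by linarith [Real.log_natCast_nonneg ⌊bigP D⌋₊]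
    calc Real.exp (8 * π) * frakP D * (1 + Real.log (⌊bigP D⌋₊ : ℕ))
        ≤ Real.exp (8 * π) * (2 * bigP D ^ 2) * (2 * ell D ^ 36) := by gcongr; exact hPfr D hDP
      _ = (2 * Real.exp (4 * π) * bigP D * ell D ^ 18) ^ 2 := by
          rw [show (2 * Real.exp (4 * π) * bigP D * ell D ^ 18) ^ 2 =
            4 * Real.exp (4 * π) ^ 2 * bigP D ^ 2 * ell D ^ 36 by ring, he8]; ring
  have hSB : ∑ x ∈ finsetOf (PsiOne χ), ‖Bpoly χ x s‖ ^ 2 ≤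
      (Real.exp (4 * π) * ((1 + ‖iota2‖) * (‖iota3‖ + ‖iota4‖)) * Real.sqrt (majorantConst 4 4) *
        Real.sqrt (frakP D) * ell D ^ 18) ^ 2 := by
    refine (meanSq_Bpoly_le_frakP χ hL3 (finsetOf (PsiOne χ)) hs2).trans ?_
    have hlog4 : Real.log (⌊bigP D⌋₊ : ℕ) ^ 4 ≤ ell D ^ 36 := by
      calc Real.log (⌊bigP D⌋₊ : ℕ) ^ 4 ≤ (ell D ^ 9) ^ 4 :=
            pow_le_pow_left₀ (Real.log_natCast_nonneg _) hlogP.1 4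
        _ = ell D ^ 36 := by ring
    rw [sq_scaleB _ _ _ _ _ (majorantConst_pos _ _).le hfrakP0, he8]
    have hm0 : 0 ≤ majorantConst 4 4 := (majorantConst_pos _ _).le
    calc Real.exp (8 * π) * frakP D * (((1 + ‖iota2‖) * (‖iota3‖ + ‖iota4‖)) ^ 2 *
          (majorantConst 4 4 * Real.log (⌊bigP D⌋₊ : ℕ) ^ 4))
        ≤ Real.exp (8 * π) * frakP D * (((1 + ‖iota2‖) * (‖iota3‖ + ‖iota4‖)) ^ 2 *
          (majorantConst 4 4 * ell D ^ 36)) := by gcongr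
      _ = _ := by ring
  -- (5) assemble
  have hfin := assembly_le (finsetOf (PsiOne χ)) (by positivity : 0 ≤ max C₅₉ 0 * ell D ^ 9)
    (Real.exp_nonneg 16) hC₆0 (by positivity) (by positivity) (by positivity) hpt
    (by simpa only [← norm_mul] using hSKK) (by simpa only [← norm_mul] using hSNK) hSEK hSK hSB
  refine hfin.trans (le_of_eq ?_)
  ring

/-- **(β) POINTWISE, eventual form in `c′`** (Prop. 2.2 holds for every large `c′`:
`Skeleton.prop22_eventually`). [cite: Zhang2022LandauSiegel, §15 p. 80, tex L4020] -/
theorem sum_norm_M1_le_eventually :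
    ∃ c₀ : ℝ, ∀ c' : ℝ, c₀ ≤ c' →
      ∃ C : ℝ, 0 ≤ C ∧ ForAllLarge fun D _ χ => AssumptionA D χ → ∀ s : ℂ, MemJ D (-alpha D) s →
        ∑ x ∈ finsetOf (PsiOne χ),
          ‖GammaFactor.tau χ * χ (x.p : ZMod D) * conj (x.ψ (D : ZMod x.p)) *
              (((x.p : ℝ) * t0 D : ℝ) : ℂ) ^ (-beta3 c' D) * (D : ℂ) ^ (s - 1) *
              (x.ψ⁻¹.LFunction (1 - s - beta1 c' D) * x.ψ⁻¹.LFunction (1 - s - beta2 c' D) /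
                x.ψ⁻¹.LFunction (1 - s)) *
              Bpoly χ x s * Kchar D (psiBarFn x) (1 - s - beta3 c' D)‖ ≤
          C * bigP D * Real.sqrt (frakP D) * ell D ^ 45 := by
  obtain ⟨c₀, hc₀, h⟩ := prop22_eventually
  exact ⟨c₀, fun c' hc' => sum_norm_M1_le_of_prop22 (hc₀.trans hc') (h c' hc')⟩

end PartC

end Literature.NumberTheory.LFunctions.Zhang2022.Typed.Section15A
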